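/-
Copyright: the b2b-balaban cell (near-miss cell 7), T⁴-continuum fan-out; row NE7b ROUND-2 swarm, seat
t4-ne7b-formalise-leaf-03 (row S12 «ASSEMBLY» of `t4/b2b-balaban-t4-ne7b-p1/LEAVES-NE7b.md`; node A12 of the typer's
`t4/formal/NE7b/DAG.md`).  Released under the licence of the surrounding project.
-/
import Summits.QuantumFields.BalabanUV.T4Continuum.Support.HistoryAssemblyTermsLE
import Summits.QuantumFields.BalabanUV.T4Continuum.Support.HistoryAssemblyPedigree
import Summits.QuantumFields.BalabanUV.T4Continuum.Support.HistoryRealiseTimed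

/-!
# History assembly, LE currency: the `Realises` bridge (node A12-I.2) and its END

Summits-side support file of the T⁴-continuum cell (rung (B)+1 on a FINITE torus only; NOT infinite volume, NOT the
mass gap, NOT the Clay statement; NOT a proof of the spine estimate NE7b).  Row S12 «ASSEMBLY» (suggested token S12b
`HistoryAssemblyRealise`) of the ROUND-2 swarm table `t4/b2b-balaban-t4-ne7b-p1/LEAVES-NE7b.md`; node **A12-I.2** of the
typer's `t4/formal/NE7b/DAG.md` v2.3 («THE BRIDGE `PedigreeReading(LE)` ⇐ `Realises`», typer T-NE7b-5, leaf-08 l.6824).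

WHY.  In the `≤` currency of row S4c the member facts the count needs — `ConsistentTLE`, well-formedness, pending —
follow from the GEOMETRY of row S1b (leaf-08): a live component whose region history `PGen` is REALISED by the blocked
persistence dynamics (`HistoryRealise.Realises L s R P Z`) and still PENDING at the cutoff
(`PendingAt L s R P.lastStep Z K`) has a `ConsistentTLE` tagged genealogy (`consistentTLE_genT_of_realises`) inside its
booked life (`lt_reach_genT_of_pendingAt`); well-formedness is then leaf-02's
`HistoryTreeShapeLE.wf_of_consistentTLE_freshT_chrono` with leaf-09's `freshT_genT` ∕ `chronoC_genT`.  No timing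
structure (`Timed`, `TimedLE`, `RenewAtReach`, `JoinInLife`) is displayed any more.

WHAT.  §1 **`structure RealisedReading`** — the displayed H3 reading map in its geometric form: per cutoff `K ≥ K₀` and
term `τ ∈ T K` a pedigree `ped K τ` (leaf-09) with region payloads `cellP K τ : π → Pt d × Finset (Pt d)` (leaf-08's
`(anchor, region)`), its live components `liveC K τ` and their root cells `cellOf K τ`; fields: `renew_step` (encoding:
a renewal is dated one step after the renewed part), `forest`, `headOldest` (well-formedness of the READING MAP —
ACCEPT-A12I §B5), **`real`**: every live component is realised and pending at `K` (`∃ Z, Realises … ∧ PendingAt …`), and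
the two ROOT-CELL fields `cell_mem` ∕ `cell_inj` (node A12-I.2 (iii), torus reduction + cells — the one piece still with
rows S6 pt 3b∕3c (leaf-01) and `HistorySlots` (leaf-10); displayed here verbatim).  §2 **`termReadingLE_of_realised`**:
the LE term reading of `HistoryAssemblyTermsLE` for `HistoryAssemblyPedigree.memOf` under the side conditions of
leaf-08's lemmas (`4 ≤ L`, drop control of the S-profile, `1 ≤ R K t`, `13 ≤ C.n₁` — DISPLAYED).  §3 the END
**`hybridNE7_of_realisedReading_canon`** = `HistoryAssemblyTermsLE.hybridNE7_of_termReadingLE_canon` with the term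
reading SUPPLIED by §2: NE7b's COUNT exit (LE currency, shape-free threshold `irThresholdTLE`) and seam, with the live
structures read as REALISED PENDING PEDIGREES.  [folklore] finite bookkeeping + composition of landed lemmas by name;
ONE new `structure … : Prop` (hypothesis shape, trigger condition c1); no `[cite:]` tag, nothing printed asserted.

HONEST DEPENDENCY (cell): continuum YM on T⁴ ⇐ BetaPertH ∧ nine spine estimates (0/9 proved); BetaPertH ⇐ (D1) ∧ (D4)
∧ CAP+tail.  Nothing of H3 ∕ (B) ∕ BetaPertH is discharged here (H3 = that the live structures of the bad terms ARE
realised pending pedigrees with these root cells, and the printed per-term prices); NE7b is NOT proved; no date.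
-/

open Finset MeasureTheory
open Literature.MathematicalPhysics.QuantumFieldTheory.Balaban1983to89
open T4PersistenceDictionary T4PersistentHistoryCount T4BankedInduction T4PrintedShapeBanking
open T4WeightBudget T4GlobalDenominator T4LiveClassFibration T4LiveStructureGas T4LiveGasToTerms T4RecordPriceSeam
open T4PartnerMultiplicity T4IndicatorShell T4MatchingAssembly T4MatchingClosure T4MatchingClosureSocket T4Continuum
open T4StabilitySocket T4BranchingRecordsGas T4TaggedShapeBanking T4CanonicalMenus T4RenewalChains
open Summit.QuantumFields.BalabanUV.T4Continuum.PlacementBatch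
open Summit.QuantumFields.BalabanUV.T4Continuum.PlacementSkeleton
open Summit.QuantumFields.BalabanUV.T4Continuum.CountThresholdUniform
open Summit.QuantumFields.BalabanUV.T4Continuum.CountThresholdExit
open Summit.QuantumFields.BalabanUV.T4Continuum.CountSeamJunction
open Summit.QuantumFields.BalabanUV.T4Continuum.LateMergers
open Summit.QuantumFields.BalabanUV.T4Continuum.HistoryFlow
open Summit.QuantumFields.BalabanUV.T4Continuum.HistoryRegeneration
open Summit.QuantumFields.BalabanUV.T4Continuum.HistoryTables
open Summit.QuantumFields.BalabanUV.T4Continuum.HistoryAssemblyTrees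
open Summit.QuantumFields.BalabanUV.T4Continuum.HistorySocketTH
open Summit.QuantumFields.BalabanUV.T4Continuum.HistoryAssemblyTerms
open Summit.QuantumFields.BalabanUV.T4Continuum.HistoryGen
open Summit.QuantumFields.BalabanUV.T4Continuum.HistoryCaps
open Literature.MathematicalPhysics.QuantumFieldTheory.Balaban1983to89.B13ScaleTransfer
open Summit.QuantumFields.BalabanUV.T4Continuum.ZoneSkeleton
open Summit.QuantumFields.BalabanUV.T4Continuum.HistoryAssemblyPedigree
open Summit.QuantumFields.BalabanUV.T4Continuum.HistoryBankingLE
open Summit.QuantumFields.BalabanUV.T4Continuum.HistoryTreeShapeLE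
open Summit.QuantumFields.BalabanUV.T4Continuum.HistoryExitLE
open Summit.QuantumFields.BalabanUV.T4Continuum.HistoryAssemblyTreesLE
open Summit.QuantumFields.BalabanUV.T4Continuum.HistoryAssemblyTermsLE
open Summit.QuantumFields.BalabanUV.T4Continuum.HistoryRealise

namespace Summit.QuantumFields.BalabanUV.T4Continuum.HistoryAssemblyRealiseLE

noncomputable section

/-! ## §1 Terms read as realised pending pedigrees -/

section Reading

variable {ι α π γ : Type*} [DecidableEq α] [DecidableEq π] [DecidableEq γ] {d : ℕ}

/-- **THE PER-TERM READING AS REALISED PENDING PEDIGREES** (the displayed H3 reading map in geometric form).  For every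
cutoff `K ≥ K₀` and term `τ ∈ T K`: the pedigree `ped K τ` dates renewals one step after the renewed part
(`renew_step`), is a FOREST listed OLDEST LINE FIRST; every live component's region history
`(ped K τ).toPGen (cellP K τ) c` is REALISED by the blocked persistence dynamics on the torus of side `L` with S-profile
`s` and size function `R K`, and PENDING at `K`; the root cell of a live component is a cell of the root's age, and
distinct live components have distinct root cells (the torus-reduction fields, displayed). [folklore] -/
structure RealisedReading (L : ℕ) (s : ℕ → ℕ) (Cell : ℕ → ℕ → Finset γ) (K₀ : ℕ) (R : ℕ → ℕ → ℕ) (T : ℕ → Finset ι)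
    (ped : ℕ → ι → Pedigree α π) (cellP : ℕ → ι → π → Pt d × Finset (Pt d)) (liveC : ℕ → ι → Finset α)
    (cellOf : ℕ → ι → α → γ) : Prop where
  /-- encoding: a renewal is dated one step after the renewed part -/
  renew_step : ∀ K, K₀ ≤ K → ∀ τ ∈ T K, ∀ c c', Part.old c' true ∈ (ped K τ).parts c →
    (ped K τ).step c' + 1 = (ped K τ).step c
  /-- the pedigree is a forest -/
  forest : ∀ K, K₀ ≤ K → ∀ τ ∈ T K, ∀ c, (ped K τ).Forest c
  /-- oldest line first at every component -/
  headOldest : ∀ K, K₀ ≤ K → ∀ τ ∈ T K, ∀ c, (ped K τ).HeadOldest c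
  /-- every live component is realised by the blocked dynamics and pending at the cutoff -/
  real : ∀ K, K₀ ≤ K → ∀ τ ∈ T K, ∀ c ∈ liveC K τ, ∃ Z : Finset (Pt d),
    Realises L s (R K) ((ped K τ).toPGen (cellP K τ) c) Z ∧
      PendingAt L s (R K) ((ped K τ).toPGen (cellP K τ) c).lastStep Z K
  /-- the root cell of a live component is a cell of the root's age -/
  cell_mem : ∀ K, K₀ ≤ K → ∀ τ ∈ T K, ∀ c ∈ liveC K τ, cellOf K τ c ∈ Cell K (K - ((ped K τ).genT c).rootStep)
  /-- distinct live components of one term have distinct root cells -/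
  cell_inj : ∀ K, K₀ ≤ K → ∀ τ ∈ T K, Set.InjOn (cellOf K τ) (liveC K τ : Set α)

end Reading

/-! ## §2 The realised reading gives the LE term reading -/

section ToTerms

variable {ι α π γ : Type*} [DecidableEq α] [DecidableEq π] [DecidableEq γ] {d : ℕ} {L : ℕ} {s : ℕ → ℕ}
  {C : T4PrintedShapeBanking.Consts} {Cell : ℕ → ℕ → Finset γ} {K₀ : ℕ} {R : ℕ → ℕ → ℕ} {T : ℕ → Finset ι}
  {ped : ℕ → ι → Pedigree α π} {cellP : ℕ → ι → π → Pt d × Finset (Pt d)} {liveC : ℕ → ι → Finset α}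
  {cellOf : ℕ → ι → α → γ}

/-- **THE REALISED READING GIVES THE LE TERM READING** for the member map `memOf`, caps `dcapOf`∕`ncapOf` read off the
data, any matching scale, under leaf-08's side conditions (`4 ≤ L`, drop control, `1 ≤ R K t`, `13 ≤ C.n₁`):
`consistent` by `consistentTLE_genT_of_realises`, `pending` by `lt_reach_genT_of_pendingAt` (row S1b), `wf` by
`wf_of_consistentTLE_freshT_chrono` (row S4c) with `freshT_genT` ∕ `chronoC_genT` (row S3), `chrono` by `chronoC_genT`,
`fat_lt`∕`fuel_le` by `HistoryCaps` (row S5), `cell_mem` from the reading, `inj` from distinct root cells. [folklore] -/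
theorem termReadingLE_of_realised (hL : 4 ≤ L) (hdrop : ∀ m, B16SProfile.DropCtl s m) (hn₁ : 13 ≤ C.n₁)
    (hR1 : ∀ K, K₀ ≤ K → ∀ t, 1 ≤ R K t) (H : RealisedReading L s Cell K₀ R T ped cellP liveC cellOf)
    (jstar : ℕ → ℕ) :
    TermReadingLE Prod.fst C Cell (dcapOf Prod.fst T (memOf ped liveC cellOf)) (ncapOf T (memOf ped liveC cellOf))
      jstar K₀ R T (memOf ped liveC cellOf) where
  consistent K hK τ hτ q hq := by
    obtain ⟨c, hc, rfl⟩ := mem_memOf.1 hq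
    obtain ⟨Z, hre, hpend⟩ := H.real K hK τ (mem_badTerms.1 hτ).1 c hc
    exact consistentTLE_genT_of_realises hL hdrop (hR1 K hK) C hn₁ (ped K τ) (cellP K τ)
      (H.renew_step K hK τ (mem_badTerms.1 hτ).1) hre hpend.1
  wf K hK τ hτ q hq := by
    obtain ⟨c, hc, rfl⟩ := mem_memOf.1 hq
    obtain ⟨Z, hre, hpend⟩ := H.real K hK τ (mem_badTerms.1 hτ).1 c hc
    exact wf_of_consistentTLE_freshT_chrono
      (consistentTLE_genT_of_realises hL hdrop (hR1 K hK) C hn₁ (ped K τ) (cellP K τ)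
        (H.renew_step K hK τ (mem_badTerms.1 hτ).1) hre hpend.1)
      (Pedigree.freshT_genT (H.forest K hK τ (mem_badTerms.1 hτ).1) c)
      (Pedigree.chronoC_genT (H.headOldest K hK τ (mem_badTerms.1 hτ).1) c)
  pending K hK τ hτ q hq := by
    obtain ⟨c, hc, rfl⟩ := mem_memOf.1 hq
    obtain ⟨Z, hre, hpend⟩ := H.real K hK τ (mem_badTerms.1 hτ).1 c hc
    exact lt_reach_genT_of_pendingAt hL hdrop (hR1 K hK) C hn₁ (ped K τ) (cellP K τ)
      (H.renew_step K hK τ (mem_badTerms.1 hτ).1) hre hpend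
  cell_mem K hK τ hτ q hq := by
    obtain ⟨c, hc, rfl⟩ := mem_memOf.1 hq
    exact H.cell_mem K hK τ (mem_badTerms.1 hτ).1 c hc
  chrono K hK τ hτ q hq := by
    obtain ⟨c, -, rfl⟩ := mem_memOf.1 hq
    exact Pedigree.chronoC_genT (H.headOldest K hK τ (mem_badTerms.1 hτ).1) c
  fat_lt K hK τ hτ q hq e he hk :=
    fat_lt_of_mem Prod.fst T (memOf ped liveC cellOf) K₀ K hK τ (mem_badTerms.1 hτ).1 q hq e he hk
  fuel_le K hK τ hτ q hq := fuel_le_of_mem T (memOf ped liveC cellOf) K₀ K hK τ (mem_badTerms.1 hτ).1 q hq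
  inj K hK τ hτ := by
    intro q hq q' hq' hs
    obtain ⟨c, hc, rfl⟩ := mem_memOf.1 (Finset.mem_coe.1 hq)
    obtain ⟨c', hc', rfl⟩ := mem_memOf.1 (Finset.mem_coe.1 hq')
    have hcell : cellOf K τ c = cellOf K τ c' := by
      have := congrArg (fun s : BSlot γ PEv => s.2.1) hs
      simpa [bslotOf] using this
    have hcc : c = c' := H.cell_inj K hK τ (mem_badTerms.1 hτ).1 (Finset.mem_coe.2 hc) (Finset.mem_coe.2 hc') hcell
    subst hcc
    rfl

end ToTerms

/-! ## §3 The END: NE7b's COUNT exit (LE) and seam with the live structures read as realised pending pedigrees -/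

section End

variable {F : T4Family} {G : Type*} [GaugeGroup G] [MeasurableSpace G] [HaarData G] [RegularGaugeGroup G]
variable {α π : Type*} [DecidableEq α] [DecidableEq π] {dP : ℕ} {sP : ℕ → ℕ}
variable {ι : Type*} [DecidableEq ι] {l₀ vol : ℝ} {K₀ : ℕ} {T : ℕ → Finset ι} {A A' shA shB : ℕ → ℝ → ι → ℝ}
  {dead dead' : ℕ → ℝ → ι → ℝ} {nup mup : ℕ → ℝ → ℝ} {Nup : ℝ}
  {Cc Rr CcRec RrRec : ℕ → ℝ → ι → ℝ} {ν u s₂ q₀ r s Wsh : ℕ → ℝ}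

/-- **NE7b's COUNT EXIT WITH THE LIVE STRUCTURES READ AS REALISED PENDING PEDIGREES** (LE currency, shape-free
threshold; NO timing display).  `HistoryAssemblyTermsLE.hybridNE7_of_termReadingLE_canon` with the term reading SUPPLIED
by `termReadingLE_of_realised` from the displayed `RealisedReading` of the reading map `ped`∕`cellP`∕`liveC`∕`cellOf`.
Displayed: the side conditions `4 ≤ L`, drop control of the S-profile `sP`, `13 ≤ C.n₁`, `1 ≤ R K t`; the reading map +
`RealisedReading` (encoding facts `renew_step`∕`forest`∕`headOldest`, the geometric fact `real`, the root-cell facts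
`cell_mem`∕`cell_inj`); the per-term price readings; the `Regeneration` numerator fields per run over the classes
`bstrOf Prod.fst (memOf …)` ∕ `badClasses …`; constants + two largeness conditions; flow side (⇐ BetaPertH); tuning;
`irThresholdTLE C F.L rr β₀ ≤ log g⁻²`; the (2.5) side condition; the (B) side; the seam data. [folklore] -/
theorem hybridNE7_of_realisedReading_canon (D : FiniteEpsData F G) {C : T4PrintedShapeBanking.Consts}
    {rr : ℕ} {β₀ : ℝ} (h : ThresholdOK C F.L rr β₀) (hμ : 0 < C.μ) (d n : ℕ)
    (hκ₁ : (d : ℝ) * Real.log F.L + 2 * Real.log 2 ≤ C.κ₁) (hE₀ : Real.log (2 + birthMass C) ≤ C.E₀)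
    -- the flow side (⇐ BetaPertH, displayed) and tuning
    {γ₀ γb b β' : ℝ} {pe : ℕ} (hb : 0 ≤ b) (hlo : FlowStep.BetaLowerH b γ₀ D.βfun)
    (hhi : FlowStep.BetaUpperH β' γ₀ D.βfun) (hγ : γb ≤ γ₀) (hγβ : γb ^ 2 * β' < 1)
    (S : B14FlowStep.SmallnessFor γb β' β₀ F.L pe) (hp₀ : C.p₀ ≤ pe) (hrr : rr ≤ pe)
    {g : ℝ} {g₀ : ℕ → ℝ} (ht : D.Tuned γb g g₀)
    (hir : irThresholdTLE C F.L rr β₀ ≤ Real.log (g ^ 2)⁻¹)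
    -- the (B) side
    (hsign : B16.SignConventions D.C) {γB : ℝ} {em ep : ℝ → ℝ} (hcor : B16.Cor3With D.C γB em ep) (hγB : γb ≤ γB)
    {obs : (K : ℕ) → GaugeField (F.P K) 0 G → ℝ} {B : ℝ}
    (hobs : ∀ K, Measurable (obs K)) (hbd : ∀ K U, |obs K U| ≤ B)
    (hα : ∀ K t, |t| ≤ l₀ → K₀ ≤ K →
      ∫ U, Real.exp (t * obs K U) * D.dens K (g₀ K) 0 U ∂fieldMeasure (F.P K) 0 G ≤ ∑ τ ∈ T K, A K t τ)
    (hα' : ∀ K t, |t| ≤ l₀ → K₀ ≤ K →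
      ∫ U, Real.exp (t * obs (K + 1) U) * D.dens (K + 1) (g₀ (K + 1)) 0 U ∂fieldMeasure (F.P (K + 1)) 0 G ≤
        ∑ τ ∈ T K, A' K t τ)
    {c₀ n₁ : ℝ} (hc₀ : 0 < c₀) (hfloor : ∀ K, K₀ ≤ K → c₀ ≤ smallFieldMass D K (g₀ K))
    (hfloor' : ∀ K, K₀ ≤ K → c₀ ≤ smallFieldMass D (K + 1) (g₀ (K + 1)))
    (hsites : ∀ K, K₀ ≤ K → ((D.C ⟨K, F.m, g₀ K⟩).numSites K : ℝ) ≤ n₁)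
    (hsites' : ∀ K, K₀ ≤ K → ((D.C ⟨K + 1, F.m, g₀ (K + 1)⟩).numSites (K + 1) : ℝ) ≤ n₁)
    (hNup : 0 ≤ Nup) (hnup : ∀ K t, |t| ≤ l₀ → K₀ ≤ K → 0 ≤ nup K t ∧ nup K t ≤ Nup)
    (hmup : ∀ K t, |t| ≤ l₀ → K₀ ≤ K → 0 ≤ mup K t ∧ mup K t ≤ Nup)
    -- the (2.5) side condition on the size function
    (R : ℕ → ℕ → ℕ) (hR : ∀ K s, s ≤ K → B14.IsRj F.L rr ((D.C ⟨K, F.m, g₀ K⟩).flow.g s) (R K s))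
    -- the side conditions of the geometric lemmas (row S1b): torus side, drop control, size function, window constant
    (hL4 : 4 ≤ F.L) (hdrop : ∀ m, B16SProfile.DropCtl sP m) (hn₁ : 13 ≤ C.n₁) (hR1 : ∀ K, K₀ ≤ K → ∀ t, 1 ≤ R K t)
    -- H3: the terms read as REALISED PENDING PEDIGREES of live components with root cells
    (ped : ℕ → ι → Pedigree α π) (cellP : ℕ → ι → π → Pt dP × Finset (Pt dP)) (liveC : ℕ → ι → Finset α)
    (cellOf : ℕ → ι → α → (Fin d → ℕ))
    (H : RealisedReading F.L sP (cellN d n F.L) K₀ R T ped cellP liveC cellOf)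
    {Fc Rf Fc' Rf' : ℕ → Finset (BSlot (Fin d → ℕ) PEv) → ℝ}
    (hprice : ∀ K t, |t| ≤ l₀ → K₀ ≤ K → ∀ τ ∈ badTerms (memOf ped liveC cellOf) jhalf T K,
      Fc K (bstrOf Prod.fst (memOf ped liveC cellOf) K τ) * Rf K (bstrOf Prod.fst (memOf ped liveC cellOf) K τ) ≤
        ∏ q ∈ memOf ped liveC cellOf K τ,
          priceT Prod.fst C ((F.L : ℝ) ^ d) R (fun K => (D.C ⟨K, F.m, g₀ K⟩).flow.g) K q)
    (hprice' : ∀ K t, |t| ≤ l₀ → K₀ ≤ K → ∀ τ ∈ badTerms (memOf ped liveC cellOf) jhalf T K,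
      Fc' K (bstrOf Prod.fst (memOf ped liveC cellOf) K τ) * Rf' K (bstrOf Prod.fst (memOf ped liveC cellOf) K τ) ≤
        ∏ q ∈ memOf ped liveC cellOf K τ,
          priceT Prod.fst C ((F.L : ℝ) ^ d) R (fun K => (D.C ⟨K, F.m, g₀ K⟩).flow.g) K q)
    -- H3: the remaining `Regeneration` numerator readings, over the classes of the terms
    (up : ∀ K t, |t| ≤ l₀ → K₀ ≤ K → ∀ c ∈ badClasses Prod.fst (memOf ped liveC cellOf) jhalf T K,
      ∀ τ ∈ fibre (bstrOf Prod.fst (memOf ped liveC cellOf)) T K c, A K t τ ≤ dead K t τ * Fc K c * nup K t)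
    (dead_nonneg : ∀ K t, |t| ≤ l₀ → K₀ ≤ K → ∀ c ∈ badClasses Prod.fst (memOf ped liveC cellOf) jhalf T K,
      ∀ τ ∈ fibre (bstrOf Prod.fst (memOf ped liveC cellOf)) T K c, 0 ≤ dead K t τ)
    (resum : ∀ K t, |t| ≤ l₀ → K₀ ≤ K → ∀ c ∈ badClasses Prod.fst (memOf ped liveC cellOf) jhalf T K,
      ∑ τ ∈ fibre (bstrOf Prod.fst (memOf ped liveC cellOf)) T K c, dead K t τ ≤ Rf K c)
    (F_nonneg : ∀ K t, |t| ≤ l₀ → K₀ ≤ K → ∀ c ∈ badClasses Prod.fst (memOf ped liveC cellOf) jhalf T K, 0 ≤ Fc K c)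
    (up' : ∀ K t, |t| ≤ l₀ → K₀ ≤ K → ∀ c ∈ badClasses Prod.fst (memOf ped liveC cellOf) jhalf T K,
      ∀ τ ∈ fibre (bstrOf Prod.fst (memOf ped liveC cellOf)) T K c, A' K t τ ≤ dead' K t τ * Fc' K c * mup K t)
    (dead'_nonneg : ∀ K t, |t| ≤ l₀ → K₀ ≤ K → ∀ c ∈ badClasses Prod.fst (memOf ped liveC cellOf) jhalf T K,
      ∀ τ ∈ fibre (bstrOf Prod.fst (memOf ped liveC cellOf)) T K c, 0 ≤ dead' K t τ)
    (resum' : ∀ K t, |t| ≤ l₀ → K₀ ≤ K → ∀ c ∈ badClasses Prod.fst (memOf ped liveC cellOf) jhalf T K,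
      ∑ τ ∈ fibre (bstrOf Prod.fst (memOf ped liveC cellOf)) T K c, dead' K t τ ≤ Rf' K c)
    (F'_nonneg : ∀ K t, |t| ≤ l₀ → K₀ ≤ K → ∀ c ∈ badClasses Prod.fst (memOf ped liveC cellOf) jhalf T K,
      0 ≤ Fc' K c)
    -- the seam's other inputs
    (hSh : ShellWeightBound l₀ T A A' shA shB Wsh)
    (hTB : ReindexedBudget l₀ vol T (fun K t τ => A K t τ - shA K t τ) (fun K t τ => A' K t τ - shB K t τ)
      (badOfClass (bstrOf Prod.fst (memOf ped liveC cellOf)) T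
        (fun K _ => badClasses Prod.fst (memOf ped liveC cellOf) jhalf T K)) Cc Rr CcRec RrRec ν u s₂ q₀ r s)
    (hr : Summable r) (hu : Summable u) (hs : Summable s) (hs₂ : Summable s₂) :
    ∃ K₁ K₂, K₀ ≤ K₁ ∧ HybridNE7 l₀ vol (fun K => T (K₁ + (K₂ + K))) (fun K => A (K₁ + (K₂ + K)))
      (fun K => A' (K₁ + (K₂ + K)))
      (fun K => badOfClass (bstrOf Prod.fst (memOf ped liveC cellOf)) T
        (fun K _ => badClasses Prod.fst (memOf ped liveC cellOf) jhalf T K) (K₁ + (K₂ + K)))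
      (fun K => constOf l₀ B (max (em g) 0) n₁ c₀ Nup *
        recordsBudget (birthMass C) C.κ₁ ((n : ℝ) ^ d) ((F.L : ℝ) ^ d) (Real.log 2) jhalf (K₁ + (K₂ + K)))
      (fun K => shA (K₁ + (K₂ + K))) (fun K => shB (K₁ + (K₂ + K))) (fun K => Wsh (K₁ + (K₂ + K)))
      (fun K => (r (K₁ + (K₂ + K)) + u (K₁ + (K₂ + K))) + (s (K₁ + (K₂ + K)) + s₂ (K₁ + (K₂ + K)))) :=
  hybridNE7_of_termReadingLE_canon D Prod.fst h hμ d n (dcapOf Prod.fst T (memOf ped liveC cellOf))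
    (ncapOf T (memOf ped liveC cellOf)) hκ₁ hE₀ hb hlo hhi hγ hγβ S hp₀ hrr ht hir hsign hcor hγB hobs hbd hα hα' hc₀
    hfloor hfloor' hsites hsites' hNup hnup hmup R hR (memOf ped liveC cellOf) (termReadingLE_of_realised hL4 hdrop hn₁ hR1 H jhalf) hprice
    hprice' up dead_nonneg resum F_nonneg up' dead'_nonneg resum' F'_nonneg hSh hTB hr hu hs hs₂

end End

end

end Summit.QuantumFields.BalabanUV.T4Continuum.HistoryAssemblyRealiseLE
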